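import Literature.Computability.AlgebraicComplexity.IK2020TableauLiftingAlphabet
import HarnessLib

/-!
# Ikenmeyer–Kandasamy 2020, §16: the right part of the lifted tableau (even `D`)

References: C. Ikenmeyer, U. Kandasamy, "Implementing geometric complexity theory: on the
separation of orbit closures via symmetries", STOC 2020 / arXiv:1911.03990 (bib key
`IkenmeyerKandasamy2019`), §16 "Construction of `rightpart(T)` for even `D`" (TeX L1930–2010;
chunk p0023.txt:L1–27 of the held text `paper:arxiv-1911.03990`) and §17, proofs of parts (3) and
(1) of Thm. 13.1 (chunk p0024.txt:L14–22, p0025.txt:L13–20).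

Brick E3 of the multi-seat program for the named fact `IK2020_thm_13_1`
(`AC/IK20HighestWeightVectors.lean`; route note `HOME/bip/NOTE-t08g4-IK2020Thm131-route.md`), on
top of brick E1 (`AC/IK2020TableauLiftingAlphabet.lean`: the alphabet `IK2020.LiftSym`, the letter
map `LiftSym.base`, `exists_perm_extend_of_injOn`). Theorem-only; no named fact; net debt 0.
Honest framing: bookkeeping of one step of a published proof; VP ≠ VNP is NOT proved and nothing
here is progress on it.

## Contents

* §A **Refinement with prescribed fibres** (`exists_fun_card_fibre_eq`, `exists_refinement`): a
  map `f : B → I` can be lifted through `p : T → I` to a map `g : B → T` (`p ∘ g = f`) whose fibres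
  have any prescribed sizes `q : T → ℕ` adding up fibrewise to the sizes of the fibres of `f`.
  This is the existence argument of §16 (chunk p0023.txt:L13–22): "We construct `rightpart(T)` by
  arbitrarily replacing `D - n(i_ℓ)` many entries `i` in `S` by the symbol `i_ℓ` … Claim 26 shows
  that this procedure replaces exactly all entries of `S`."
* §B the content of a column tableau as a fibre cardinality over its boxes, the `Σ`-type of
  pairs (column, row-in-column) (`ColTableau.card_filter_box_eq_count`).
* §C **`rightpart(T)`**: for quotas `q (i, ℓ)` with `∑_ℓ q (i, ℓ) = (content of S at i)` there is
  a filling `R` of the shape of `S` by NAME symbols with `R(□) = i_ℓ` for some `ℓ` whenever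
  `S(□) = i` (eq. (16.2) 'EVENeq:directreplacement') and with content `q (i, ℓ)` at `i_ℓ` and `0` at
  every block symbol `j_k^i` (`exists_rightpart`).
* §D consequences of 'EVENeq:directreplacement' alone (`R(□) ∈ {i_ℓ}` over `S(□) = i`): the letter
  map `φ(i_ℓ) = i`, `φ(j_k^i) = j` gives `rightpart(φ T) = S` (part (3), chunk p0024.txt:L16–17:
  "We observe that `rightpart(φ(T)) = S`"), hence regular if `S` is (`relabel_base_eq`,
  `isRegular_relabel_base`); and part (1) of Thm. 13.1 in its §17 form (chunk p0025.txt:L13–20: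
  "Therefore `φ°(S) = φ(rightpart(T))` … Claim 30 proves property (1)"): if `φ(i_ℓ) = φ°(i)` for all
  name symbols and `φ°` is injective on the letters occurring in `S`, then `rightpart(φ T) = π S`
  for a permutation `π ∈ 𝔖_m` (`exists_perm_relabel_eq_of_name_const`). The two hypotheses are
  Claims 29 and 30 of §17, which concern `leftpart(T)` and are supplied by brick E2.
-/

namespace Literature.Computability.AlgebraicComplexity

namespace IK2020

open Finset

/-! ## §A  Refinement of a map with prescribed fibre cardinalities -/

/-- A finite set `B` can be mapped to `T` with prescribed fibre sizes `q t`, provided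
`∑ q = |B|` (choose a bijection `B ≃ Σ t, Fin (q t)` and project) — the one-letter case of the
existence argument of §16 (chunk p0023.txt:L11–22). [cite: IkenmeyerKandasamy2019, §16] -/
theorem exists_fun_card_fibre_eq {B T : Type*} [Fintype B] [Fintype T] [DecidableEq T]
    (q : T → ℕ) (hq : ∑ t, q t = Fintype.card B) :
    ∃ g : B → T, ∀ t, (univ.filter fun b => g b = t).card = q t := by
  classical
  have hcard : Fintype.card B = Fintype.card (Σ t : T, Fin (q t)) := by
    rw [Fintype.card_sigma]
    simp only [Fintype.card_fin]
    exact hq.symm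
  let e : B ≃ Σ t : T, Fin (q t) := Fintype.equivOfCardEq hcard
  refine ⟨fun b => (e b).1, fun t => ?_⟩
  have h1 : (univ.filter fun b : B => (e b).1 = t) =
      (univ.filter fun x : (Σ t : T, Fin (q t)) => x.1 = t).map e.symm.toEmbedding := by
    ext b
    simp only [mem_filter, mem_univ, true_and, mem_map_equiv, Equiv.symm_symm]
  have h2 : (univ.filter fun x : (Σ t : T, Fin (q t)) => x.1 = t) =
      (univ : Finset (Fin (q t))).map (Function.Embedding.sigmaMk t) := by
    ext ⟨t', y⟩
    simp only [mem_filter, mem_univ, true_and, mem_map, Function.Embedding.sigmaMk_apply]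
    constructor
    · rintro rfl
      exact ⟨y, rfl⟩
    · rintro ⟨y', h⟩
      exact (congrArg Sigma.fst h).symm
  rw [h1, card_map, h2, card_map, card_univ, Fintype.card_fin]

/-- **Refinement with prescribed fibres.** Let `f : B → I` and `p : T → I` be maps of finite sets
and `q : T → ℕ` quotas such that, over every `i`, the quotas of the `t` with `p t = i` add up to
the size of the fibre `f⁻¹(i)`. Then `f` lifts through `p` to a map `g : B → T` (`p ∘ g = f`) with
fibres of the prescribed sizes `|g⁻¹(t)| = q t`. (The existence argument of §16: replace, for each
`ℓ`, exactly `q(i_ℓ) = D - n(i_ℓ)` of the entries `i` of `S` by `i_ℓ`; "such a tableau might not be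
unique, but we only care about its existence", chunk p0023.txt:L11–22.)
[cite: IkenmeyerKandasamy2019, §16] -/
theorem exists_refinement {B T I : Type*} [Fintype B] [Fintype T] [DecidableEq T]
    [DecidableEq I] (f : B → I) (p : T → I) (q : T → ℕ)
    (hq : ∀ i, ∑ t ∈ univ.filter (fun t => p t = i), q t = (univ.filter fun b => f b = i).card) :
    ∃ g : B → T, (∀ b, p (g b) = f b) ∧ ∀ t, (univ.filter fun b => g b = t).card = q t := by
  classical
  have H : ∀ i, ∃ G : {b // f b = i} → {t // p t = i},
      ∀ t, (univ.filter fun x => G x = t).card = q t.1 := by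
    intro i
    refine exists_fun_card_fibre_eq (fun t : {t // p t = i} => q t.1) ?_
    rw [Fintype.card_subtype, ← hq i, Finset.sum_subtype (univ.filter fun t => p t = i)
      (p := fun t => p t = i) (fun t => by simp)]
  choose G hG using H
  have hg : ∀ (b : B) (i : I) (h : f b = i), (G (f b) ⟨b, rfl⟩).1 = (G i ⟨b, h⟩).1 := by
    intro b i h
    subst h
    rfl
  refine ⟨fun b => (G (f b) ⟨b, rfl⟩).1, fun b => (G (f b) ⟨b, rfl⟩).2, fun t => ?_⟩
  have hset : (univ.filter fun b : B => (G (f b) ⟨b, rfl⟩).1 = t) =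
      (univ.filter fun x : {b // f b = p t} => G (p t) x = ⟨t, rfl⟩).map
        (Function.Embedding.subtype _) := by
    ext b
    simp only [mem_filter, mem_univ, true_and, mem_map, Function.Embedding.subtype_apply]
    constructor
    · intro hb
      have hfb : f b = p t := by
        rw [← hb]
        exact ((G (f b) ⟨b, rfl⟩).2).symm
      refine ⟨⟨b, hfb⟩, ?_, rfl⟩
      apply Subtype.ext
      rw [← hg b (p t) hfb]
      exact hb
    · rintro ⟨x, hx, rfl⟩
      rw [hg x.1 (p t) x.2, Subtype.coe_eta, hx]
  rw [hset, card_map, hG]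

/-! ## §B  Boxes of a column tableau -/

namespace ColTableau

variable {α : Type*}

/-- The content of `T` at `a` is the number of boxes of `T` carrying `a` (the boxes of a column
tableau `T` being the pairs (column, row-in-column), `Σ c : Fin T.C, Fin (T.h c)`).
[cite: IkenmeyerKandasamy2019, §3] -/
theorem card_filter_box_eq_count [DecidableEq α] (T : ColTableau α) (a : α) :
    (univ.filter fun b : (Σ c : Fin T.C, Fin (T.h c)) => T.entry b.1 b.2 = a).card = T.count a := by
  have h : (univ.filter fun b : (Σ c : Fin T.C, Fin (T.h c)) => T.entry b.1 b.2 = a) =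
      univ.sigma fun c => univ.filter fun r : Fin (T.h c) => T.entry c r = a := by
    ext ⟨c, r⟩
    simp
  rw [h, card_sigma]
  rfl

/-- The content of a filling `R` of the shape of `S`, as a number of boxes of `S`.
[cite: IkenmeyerKandasamy2019, §3] -/
theorem count_mk_eq_card_filter {β : Type*} [DecidableEq β] (S : ColTableau α)
    (R : (c : Fin S.C) → Fin (S.h c) → β) (u : β) :
    (ColTableau.mk S.C S.h R).count u =
      (univ.filter fun b : (Σ c : Fin S.C, Fin (S.h c)) => R b.1 b.2 = u).card :=
  (card_filter_box_eq_count (ColTableau.mk S.C S.h R) u).symm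

end ColTableau

/-! ## §C  Construction of `rightpart(T)` -/

section rightpart

variable {m : ℕ} {n ρ : Fin m → ℕ}

/-- Two name symbols of the same letter coincide iff their indices do.
[cite: IkenmeyerKandasamy2019, §13] -/
theorem LiftSym.name_eq_name_iff (i : Fin m) (ℓ ℓ' : Fin (n i + ρ i)) :
    (LiftSym.name i ℓ : LiftSym m n ρ) = LiftSym.name i ℓ' ↔ ℓ = ℓ' := by
  constructor
  · intro h
    have h' := Sum.inl_injective h
    exact eq_of_heq (Sigma.mk.inj_iff.mp h').2
  · rintro rfl
    rfl

/-- **Existence of `rightpart(T)`** (§16, TeX L1930–1960; chunk p0023.txt:L1–22). Given the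
regular tableau `S` over `[m]` and quotas `q(i, ℓ)` for the name symbols `i_ℓ` with
`∑_ℓ q(i, ℓ) =` (number of entries `i` of `S`) for every letter `i` — in the printed proof
`q(i, ℓ) = D - n(i_ℓ)` and the identity is Claim 26 'EVENcla:divisibility' — there is a filling
`R` of the shape of `S` ('EVENeq:sameshape') such that every box carrying `i` in `S` carries some
`i_ℓ` in `R` ('EVENeq:directreplacement'), each `i_ℓ` is used exactly `q(i, ℓ)` times, and no
block symbol `j_k^i` occurs ("The symbols `j_k^i` do not appear in `rightpart(T)`", §13).
[cite: IkenmeyerKandasamy2019, §16] -/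
theorem exists_rightpart (S : ColTableau (Fin m)) (q : (Σ i : Fin m, Fin (n i + ρ i)) → ℕ)
    (hq : ∀ i, ∑ ℓ, q ⟨i, ℓ⟩ = S.count i) :
    ∃ R : (c : Fin S.C) → Fin (S.h c) → LiftSym m n ρ,
      (∀ c r, ∃ ℓ, R c r = LiftSym.name (S.entry c r) ℓ) ∧
      (∀ i ℓ, (ColTableau.mk S.C S.h R).count (LiftSym.name i ℓ) = q ⟨i, ℓ⟩) ∧
      (∀ x, (ColTableau.mk S.C S.h R).count (Sum.inr x) = 0) := by
  classical
  obtain ⟨g, hg1, hg2⟩ := exists_refinement (B := Σ c : Fin S.C, Fin (S.h c))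
    (fun b => S.entry b.1 b.2)
    (Sigma.fst : (Σ i : Fin m, Fin (n i + ρ i)) → Fin m) q (fun i => by
      rw [ColTableau.card_filter_box_eq_count, ← hq i]
      have h : (univ.filter fun t : (Σ i : Fin m, Fin (n i + ρ i)) => t.1 = i) =
          (univ : Finset (Fin (n i + ρ i))).map (Function.Embedding.sigmaMk i) := by
        ext ⟨i', ℓ⟩
        simp only [mem_filter, mem_univ, true_and, mem_map, Function.Embedding.sigmaMk_apply]
        constructor
        · rintro rfl
          exact ⟨ℓ, rfl⟩
        · rintro ⟨ℓ', h⟩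
          exact (congrArg Sigma.fst h).symm
      rw [h, sum_map]
      rfl)
  refine ⟨fun c r => Sum.inl (g ⟨c, r⟩), fun c r => ?_, fun i ℓ => ?_, fun x => ?_⟩
  · show ∃ ℓ, (Sum.inl (g ⟨c, r⟩) : LiftSym m n ρ) = LiftSym.name (S.entry c r) ℓ
    have h1 := hg1 ⟨c, r⟩
    revert h1
    generalize g ⟨c, r⟩ = t
    obtain ⟨i, ℓ⟩ := t
    rintro (rfl : i = S.entry c r)
    exact ⟨ℓ, rfl⟩
  · rw [ColTableau.count_mk_eq_card_filter, ← hg2 ⟨i, ℓ⟩]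
    congr 1
    refine filter_congr fun b _ => ?_
    exact Sum.inl_injective.eq_iff
  · rw [ColTableau.count_mk_eq_card_filter, card_eq_zero, filter_eq_empty_iff]
    intro b _ h
    exact Sum.inl_ne_inr h

end rightpart

/-! ## §D  Consequences of 'EVENeq:directreplacement' -/

section directreplacement

variable {m : ℕ} {n ρ : Fin m → ℕ} (S : ColTableau (Fin m))
  {R : (c : Fin S.C) → Fin (S.h c) → LiftSym m n ρ}

/-- **Part (3) of Thm. 13.1, right part**: under the letter map `φ(i_ℓ) := i`, `φ(j_k^i) := j`
(`LiftSym.base`) a filling by name symbols over the entries of `S` relabels to `S` itself (§17,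
chunk p0024.txt:L16–17: "We observe that `rightpart(φ(T)) = S`, see (EVENeq:directreplacement)").
[cite: IkenmeyerKandasamy2019, §17] -/
theorem relabel_base_eq (hR : ∀ c r, ∃ ℓ, R c r = LiftSym.name (S.entry c r) ℓ) :
    (ColTableau.mk S.C S.h R).relabel LiftSym.base = S := by
  obtain ⟨C, h, e⟩ := S
  simp only [ColTableau.relabel, ColTableau.mk.injEq, heq_eq_eq, true_and]
  funext c r
  obtain ⟨ℓ, hℓ⟩ := hR c r
  rw [hℓ, LiftSym.base_name]

/-- Hence `rightpart(φ(T))` is regular for this `φ` when `S` is ("Since `S` is regular,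
`rightpart(φ(T))` is regular", chunk p0024.txt:L17–18). [cite: IkenmeyerKandasamy2019, §17] -/
theorem isRegular_relabel_base (hR : ∀ c r, ∃ ℓ, R c r = LiftSym.name (S.entry c r) ℓ)
    (hS : S.IsRegular) : ((ColTableau.mk S.C S.h R).relabel LiftSym.base).IsRegular := by
  rw [relabel_base_eq S hR]
  exact hS

/-- A box of `S` carrying `i` forces the name-symbol type `Fin (n_i + ϱ_i)` to be inhabited; in
particular letters `i` with `n_i + ϱ_i = 0` (the letters outside `I`, Claim 27: "If `i ∉ I`, then the
symbol `i_ℓ` does not appear in `T`") do not occur in `S`. [cite: IkenmeyerKandasamy2019, §16] -/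
theorem add_ne_zero_of_entry (hR : ∀ c r, ∃ ℓ, R c r = LiftSym.name (S.entry c r) ℓ)
    (c : Fin S.C) (r : Fin (S.h c)) : n (S.entry c r) + ρ (S.entry c r) ≠ 0 := by
  obtain ⟨ℓ, -⟩ := hR c r
  have := ℓ.isLt
  omega

/-- **Part (1) of Thm. 13.1 in its §17 form** (chunk p0025.txt:L13–20): "The tableau `rightpart(T)`
only contains entries `i_ℓ` … if `rightpart(T)` contains an entry `i_ℓ`, then the corresponding
entry of `S` is `i`. Therefore `φ°(S) = φ(rightpart(T))` … Claim 30 [`φ°` injective] proves property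
(1)", i.e. `rightpart(φ(T)) ∈ 𝔖_m S`. Hypotheses: `φ(i_ℓ) = φ°(i)` for all name symbols (Claim 29)
and `φ°` injective on a set `s` of letters containing all entries of `S` (Claim 30, with `s = I`);
`φ°` is extended off `s` to a permutation `π` by `exists_perm_extend_of_injOn` (E1).
[cite: IkenmeyerKandasamy2019, §17] -/
theorem exists_perm_relabel_eq_of_name_const
    (hR : ∀ c r, ∃ ℓ, R c r = LiftSym.name (S.entry c r) ℓ)
    (φ : LiftSym m n ρ → Fin m) (φ₀ : Fin m → Fin m)
    (hφ : ∀ i ℓ, φ (LiftSym.name i ℓ) = φ₀ i) (s : Finset (Fin m)) (hinj : Set.InjOn φ₀ s)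
    (hs : ∀ c r, S.entry c r ∈ s) :
    ∃ π : Equiv.Perm (Fin m), (ColTableau.mk S.C S.h R).relabel φ = S.relabel π := by
  obtain ⟨π, hπ⟩ := exists_perm_extend_of_injOn s φ₀ hinj
  refine ⟨π, ?_⟩
  obtain ⟨C, h, e⟩ := S
  simp only [ColTableau.relabel, ColTableau.mk.injEq, heq_eq_eq, true_and]
  funext c r
  obtain ⟨ℓ, hℓ⟩ := hR c r
  rw [hℓ, hφ, hπ _ (hs c r)]

/-- The same with `s = {i | ϱ_i ≠ 0} = I` when `S` has content `D ϱ` (the letters of `S` lie in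
`I`). [cite: IkenmeyerKandasamy2019, §17] -/
theorem exists_perm_relabel_eq_of_name_const' {D : ℕ}
    (hR : ∀ c r, ∃ ℓ, R c r = LiftSym.name (S.entry c r) ℓ)
    (hcnt : ∀ i, S.count i = D * ρ i)
    (φ : LiftSym m n ρ → Fin m) (φ₀ : Fin m → Fin m)
    (hφ : ∀ i ℓ, φ (LiftSym.name i ℓ) = φ₀ i) (hinj : Set.InjOn φ₀ {i | ρ i ≠ 0}) :
    ∃ π : Equiv.Perm (Fin m), (ColTableau.mk S.C S.h R).relabel φ = S.relabel π := by
  classical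
  refine exists_perm_relabel_eq_of_name_const S hR φ φ₀ hφ (univ.filter fun i => ρ i ≠ 0)
    (by simpa using hinj) fun c r => ?_
  simp only [mem_filter, mem_univ, true_and]
  intro h0
  have hpos : 0 < S.count (S.entry c r) := by
    unfold ColTableau.count
    refine Finset.sum_pos' (fun _ _ => Nat.zero_le _) ⟨c, mem_univ _, ?_⟩
    exact Finset.card_pos.mpr ⟨r, by simp⟩
  rw [hcnt, h0, mul_zero] at hpos
  exact lt_irrefl 0 hpos

end directreplacement

end IK2020

end Literature.Computability.AlgebraicComplexity
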